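import Summits.CriticalPhenomena.PercolationContinuityZ3.Theorems.SahiMasterFamilyTrichotomy

/-!
# Local trichotomy for terminal triples, II: double saturation forces the triangle (SS)

Companion of `SahiMasterFamilyTrichotomy.lean` (unit `prim-master-conj`; terminal analysis of (T), paper
STRUCTURE-PROOF.md §4 Lemma SS, verified VERIFICATION-gen3.md).  For a triple of increasing events with pairwise
intersecting essential supports, no private and no common coordinate, all of whose minors lie in `Z_3`:

* `lemma_SS` — if a shared coordinate `e ∈ esupp A ∩ esupp B` saturates both `A` and `B` and is mandatory for
  neither, then the triple is THE TRIANGLE: `esupp A = {e, s}`, `esupp B = {e, t}`, `esupp C = {s, t}` and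
  `A = {e ∨ s}`, `B = {e ∨ t}`, `C = {s ∨ t}` (`orPair`).
The proof follows the paper: the deletion at `e` is realised by `(A_e, B_e)`, which pins the supports
(`esupp A_e = esupp A ∩ esupp C`, `esupp B_e = esupp B ∩ esupp C`); the Lemma-Z side conditions and a downward induction
put the configurations `esupp A ∩ esupp C` and `esupp B ∩ esupp C` into `C`; the minors at `s ∈ esupp A ∩ esupp C` give
`C_s ⊆ B` and "`C^s` ignores `esupp B ∩ esupp C`", whence every singleton of `esupp C` lies in `C` and the classes are
singletons.  Everything here is proved; axioms standard. [this work]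
-/

noncomputable section

open scoped Classical

namespace Summit.CriticalPhenomena.PercolationContinuityZ3.Theorems

open Finset Function
open Literature.Probability.Percolation (DeterminedBy determinedBy_iff)
open Literature.Probability.LatticeModels.Kahn2022 (Affects)

variable {ι : Type*} [Fintype ι]

/-! ### Helpers -/

/-- The event "`a` or `b` is open". [folklore] -/
def orPair (a b : ι) : Set (Set ι) := {ω | a ∈ ω ∨ b ∈ ω}

/-- A nonempty increasing event contains every configuration covering its essential support. [folklore] -/
theorem mem_of_esupp_subset {X : Set (Set ι)} (hX : IsUpperSet X) (hne : X.Nonempty) {ω : Set ι}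
    (hω : (↑(esupp X) : Set ι) ⊆ ω) : ω ∈ X := by
  refine (mem_iff_of_inter_esupp_eq hX (ω := ω) (ω' := Set.univ) ?_).2 (univ_mem_of_nonempty hX hne)
  ext i
  simp only [Set.mem_inter_iff, mem_coe, Set.mem_univ, true_and, and_iff_right_iff_imp]
  exact fun hi => hω hi

/-- An increasing event other than `univ` does not contain a configuration missing its essential support. [folklore] -/
theorem not_mem_of_disjoint_esupp {X : Set (Set ι)} (hX : IsUpperSet X) (hne : X ≠ Set.univ) {ω : Set ι}
    (hω : ω ∩ ↑(esupp X) = ∅) : ω ∉ X := by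
  intro h
  have h0 : (∅ : Set ι) ∈ X := (mem_iff_of_inter_esupp_eq hX (ω := ∅) (ω' := ω) (by rw [hω, Set.empty_inter])).2 h
  exact hne (Set.eq_univ_of_forall fun η => hX (Set.empty_subset η) h0)

omit [Fintype ι] in
/-- Membership in a saturated increasing event: `ω ∈ A ↔ e ∈ ω ∨ ω ∈ A_e`. [folklore] -/
theorem mem_iff_of_saturates {A : Set (Set ι)} (hA : IsUpperSet A) {e : ι} (hsat : secAt e true A = Set.univ)
    (ω : Set ι) : ω ∈ A ↔ e ∈ ω ∨ ω ∈ secAt e false A := by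
  have hsing : ({e} : Set ι) ∈ A := (secAt_true_eq_univ_iff' hA e).1 hsat
  constructor
  · intro hω
    by_cases he : e ∈ ω
    · exact Or.inl he
    · right; rw [mem_secAt]; simp only [forceAt, cond_false]; rwa [Set.sdiff_singleton_eq_self he]
  · rintro (he | hω)
    · exact hA (Set.singleton_subset_iff.2 he) hsing
    · rw [mem_secAt] at hω; simp only [forceAt, cond_false] at hω
      exact hA Set.sdiff_subset hω

omit [Fintype ι] in
/-- Deletion membership for configurations not containing the coordinate. [folklore] -/
theorem mem_secAt_false_iff_of_notMem {X : Set (Set ι)} {s : ι} {ω : Set ι} (hs : s ∉ ω) :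
    ω ∈ secAt s false X ↔ ω ∈ X := by
  rw [mem_secAt]; simp only [forceAt, cond_false, Set.sdiff_singleton_eq_self hs]

omit [Fintype ι] in
/-- Contraction membership for configurations containing the coordinate. [folklore] -/
theorem mem_secAt_true_iff_of_mem {X : Set (Set ι)} {s : ι} {ω : Set ι} (hs : s ∈ ω) :
    ω ∈ secAt s true X ↔ ω ∈ X := by
  rw [mem_secAt]; simp only [forceAt, cond_true, Set.insert_eq_of_mem hs]

/-- Removing coordinates outside the essential support does not change membership. [folklore] -/
theorem mem_iff_sdiff_mem {X : Set (Set ι)} (hX : IsUpperSet X) {T : Finset ι} (hT : Disjoint (esupp X) T)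
    (ω : Set ι) : ω ∈ X ↔ ω \ ↑T ∈ X := by
  refine mem_iff_of_inter_esupp_eq hX ?_
  ext i
  simp only [Set.mem_inter_iff, mem_coe, Set.mem_sdiff]
  constructor
  · rintro ⟨hi, hiX⟩; exact ⟨⟨hi, fun hiT => Finset.disjoint_left.1 hT hiX hiT⟩, hiX⟩
  · rintro ⟨⟨hi, -⟩, hiX⟩; exact ⟨hi, hiX⟩

/-- If `e` saturates `A`, the deletion carries exactly the other essential coordinates. [this work] -/
theorem esupp_secAt_false_of_saturates {A : Set (Set ι)} (hA : IsUpperSet A) {e : ι}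
    (hsat : secAt e true A = Set.univ) : esupp (secAt e false A) = (esupp A).erase e :=
  Finset.Subset.antisymm (esupp_secAt_subset hA e false) (erase_subset_esupp_secAt_false hsat)

/-! ### SS -/

/-- **SS, first half**: supports of the sections, the configurations `esupp A ∩ esupp C`, `esupp B ∩ esupp C` in `C`,
and the deletions `C_s ⊆ B`, `C_t ⊆ A`. [this work] -/
theorem ss_partA {A B C : Set (Set ι)} (hA : IsUpperSet A) (hB : IsUpperSet B) (hC : IsUpperSet C)
    (hAC : (esupp A ∩ esupp C).Nonempty) (hBC : (esupp B ∩ esupp C).Nonempty)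
    (hprivA : esupp A ⊆ esupp B ∪ esupp C) (hprivB : esupp B ⊆ esupp A ∪ esupp C)
    (hprivC : esupp C ⊆ esupp A ∪ esupp B) (hcommon : ∀ i, i ∈ esupp A → i ∈ esupp B → i ∉ esupp C)
    (hmin : ∀ i ∈ esupp A ∪ esupp B ∪ esupp C, ∀ b : Bool, SuppZeroFlag 3 ![secAt i b A, secAt i b B, secAt i b C])
    {e : ι} (heA : e ∈ esupp A) (heB : e ∈ esupp B)
    (hA0 : (secAt e false A).Nonempty) (hB0 : (secAt e false B).Nonempty)
    (hsatA : secAt e true A = Set.univ) (hsatB : secAt e true B = Set.univ) :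
    esupp (secAt e false A) = esupp A ∩ esupp C ∧ esupp (secAt e false B) = esupp B ∩ esupp C ∧
      esupp C = esupp A ∩ esupp C ∪ esupp B ∩ esupp C ∧
      (↑(esupp A ∩ esupp C) : Set ι) ∈ C ∧ (↑(esupp B ∩ esupp C) : Set ι) ∈ C ∧
      (∀ s ∈ esupp A ∩ esupp C, ∀ ω ∈ secAt s false C, ω ∈ B) ∧
      (∀ t ∈ esupp B ∩ esupp C, ∀ ω ∈ secAt t false C, ω ∈ A) := by
  have heC : e ∉ esupp C := hcommon e heA heB
  -- notation and basic facts
  set IAC := esupp A ∩ esupp C with hIAC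
  set IBC := esupp B ∩ esupp C with hIBC
  have hA0u : IsUpperSet (secAt e false A) := isUpperSet_secAt e false hA
  have hB0u : IsUpperSet (secAt e false B) := isUpperSet_secAt e false hB
  have hCne : C.Nonempty := by
    obtain ⟨i, hi⟩ := hAC; exact (nonempty_of_esupp_nonempty ⟨i, (mem_inter.1 hi).2⟩).1
  have hCnu : C ≠ Set.univ := by
    obtain ⟨i, hi⟩ := hAC; exact (nonempty_of_esupp_nonempty ⟨i, (mem_inter.1 hi).2⟩).2
  have hAnu : A ≠ Set.univ := (nonempty_of_esupp_nonempty ⟨e, heA⟩).2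
  have hBnu : B ≠ Set.univ := (nonempty_of_esupp_nonempty ⟨e, heB⟩).2
  have hCe : ∀ b, secAt e b C = C := fun b => secAt_eq_self_of_not_affects hC (fun h => heC (mem_esupp.2 h)) b
  have esA0 : esupp (secAt e false A) = (esupp A).erase e := esupp_secAt_false_of_saturates hA hsatA
  have esB0 : esupp (secAt e false B) = (esupp B).erase e := esupp_secAt_false_of_saturates hB hsatB
  -- Step 1: the deletion at `e` is realised by `(A_e, B_e)`
  have hD := hmin e (by simp [heA]) false
  rw [hCe] at hD
  have hZ : ZVia (secAt e false A) (secAt e false B) C := by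
    rcases (suppZeroFlag_three_iff_zVia _ _ _).1 hD with h | h | h
    · exfalso
      obtain ⟨t, ht⟩ := hBC
      have htC := (mem_inter.1 ht).2
      have ht0 : t ∈ esupp (secAt e false B) := by
        rw [esB0, mem_erase]; exact ⟨fun hte => heC (hte ▸ htC), (mem_inter.1 ht).1⟩
      exact Finset.disjoint_left.1 (zVia_pivotal hB0u hC hA0u h).1 ht0 htC
    · exfalso
      obtain ⟨s, hs⟩ := hAC
      have hsC := (mem_inter.1 hs).2
      have hs0 : s ∈ esupp (secAt e false A) := by
        rw [esA0, mem_erase]; exact ⟨fun hse => heC (hse ▸ hsC), (mem_inter.1 hs).1⟩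
      exact Finset.disjoint_left.1 (zVia_pivotal hA0u hC hB0u h).1 hs0 hsC
    · exact h
  obtain ⟨dAB0, pa, pb⟩ := zVia_pivotal hA0u hB0u hC hZ
  -- Step 2: supports: `esupp A_e = IAC`, `esupp B_e = IBC`, `esupp C = IAC ∪ IBC`
  have esA0' : esupp (secAt e false A) = IAC := by
    ext f
    rw [esA0, mem_erase, hIAC, mem_inter]
    constructor
    · rintro ⟨hfe, hfA⟩
      refine ⟨hfA, ?_⟩
      rcases mem_union.1 (hprivA hfA) with hfB | hfC
      · exfalso
        have h1 : f ∈ esupp (secAt e false A) := by rw [esA0, mem_erase]; exact ⟨hfe, hfA⟩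
        have h2 : f ∈ esupp (secAt e false B) := by rw [esB0, mem_erase]; exact ⟨hfe, hfB⟩
        exact Finset.disjoint_left.1 dAB0 h1 h2
      · exact hfC
    · rintro ⟨hfA, hfC⟩
      exact ⟨fun hfe => heC (hfe ▸ hfC), hfA⟩
  have esB0' : esupp (secAt e false B) = IBC := by
    ext f
    rw [esB0, mem_erase, hIBC, mem_inter]
    constructor
    · rintro ⟨hfe, hfB⟩
      refine ⟨hfB, ?_⟩
      rcases mem_union.1 (hprivB hfB) with hfA | hfC
      · exfalso
        have h1 : f ∈ esupp (secAt e false A) := by rw [esA0, mem_erase]; exact ⟨hfe, hfA⟩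
        have h2 : f ∈ esupp (secAt e false B) := by rw [esB0, mem_erase]; exact ⟨hfe, hfB⟩
        exact Finset.disjoint_left.1 dAB0 h1 h2
      · exact hfC
    · rintro ⟨hfB, hfC⟩
      exact ⟨fun hfe => heC (hfe ▸ hfC), hfB⟩
  have esC : esupp C = IAC ∪ IBC := by
    ext f
    rw [mem_union, hIAC, hIBC, mem_inter, mem_inter]
    constructor
    · intro hfC
      rcases mem_union.1 (hprivC hfC) with hfA | hfB
      · exact Or.inl ⟨hfA, hfC⟩
      · exact Or.inr ⟨hfB, hfC⟩
    · rintro (⟨-, h⟩ | ⟨-, h⟩) <;> exact h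
  have hIAC_B : Disjoint IAC (esupp B) := by
    rw [Finset.disjoint_left]
    intro f hf hfB
    exact hcommon f (mem_inter.1 hf).1 hfB (mem_inter.1 hf).2
  have hIBC_A : Disjoint IBC (esupp A) := by
    rw [Finset.disjoint_left]
    intro f hf hfA
    exact hcommon f hfA (mem_inter.1 hf).1 (mem_inter.1 hf).2
  -- Step 3: `IAC ∈ C` and `IBC ∈ C` (as configurations), by downward induction
  have claimC : ∀ {X : Set (Set ι)} {P Q : Finset ι}, IsUpperSet X → X.Nonempty → esupp X = P → esupp C = P ∪ Q →
      (∀ t ∈ Q, ∀ ω ∈ X, ω ∉ C → insert t ω ∉ C) → (↑P : Set ι) ∈ C := by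
    intro X P Q hX hXne hesX hesC hpiv
    have step : ∀ σ : Finset ι, σ ⊆ Q → (↑(P ∪ (Q \ σ)) : Set ι) ∈ C := by
      intro σ
      induction σ using Finset.induction_on with
      | empty =>
        intro _
        rw [Finset.sdiff_empty, ← hesC]
        exact mem_of_esupp_subset hC hCne subset_rfl
      | insert u σ huσ ih =>
        intro hsub
        have huQ : u ∈ Q := hsub (mem_insert_self u σ)
        have hσ : σ ⊆ Q := fun i hi => hsub (mem_insert_of_mem hi)
        have hprev := ih hσ
        by_contra hY
        have heq : (↑(P ∪ (Q \ σ)) : Set ι) = insert u ↑(P ∪ (Q \ insert u σ)) := by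
          ext i
          simp only [mem_coe, mem_union, mem_sdiff, Finset.mem_insert, Set.mem_insert_iff, not_or]
          constructor
          · rintro (hi | ⟨hiQ, hiσ⟩)
            · exact Or.inr (Or.inl hi)
            · by_cases hiu : i = u
              · exact Or.inl hiu
              · exact Or.inr (Or.inr ⟨hiQ, hiu, hiσ⟩)
          · rintro (rfl | hi | ⟨hiQ, -, hiσ⟩)
            · exact Or.inr ⟨huQ, huσ⟩
            · exact Or.inl hi
            · exact Or.inr ⟨hiQ, hiσ⟩
        rw [heq] at hprev
        have hYX : (↑(P ∪ (Q \ insert u σ)) : Set ι) ∈ X :=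
          mem_of_esupp_subset hX hXne (by rw [hesX]; exact fun i hi => by simp [mem_coe.1 hi])
        exact hpiv u huQ _ hYX hY hprev
    have := step Q subset_rfl
    rwa [Finset.sdiff_self, Finset.union_empty] at this
  have hIACmem : (↑IAC : Set ι) ∈ C :=
    claimC hA0u hA0 esA0' esC (fun t ht => pa t (by rw [esB0']; exact ht))
  have hIBCmem : (↑IBC : Set ι) ∈ C :=
    claimC hB0u hB0 esB0' (by rw [esC, union_comm]) (fun s hs => pb s (by rw [esA0']; exact hs))
  -- Step 4: for `s ∈ IAC`, the deletion at `s` gives `C_s ⊆ B`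
  have hsat_mem : ∀ {X : Set (Set ι)}, IsUpperSet X → secAt e true X = Set.univ → ∀ {s : ι}, s ≠ e →
      ∀ b : Bool, ({e} : Set ι) ∈ secAt s b X := by
    intro X hX hsat s hse b
    rw [mem_secAt]
    have hsing : ({e} : Set ι) ∈ X := (secAt_true_eq_univ_iff' hX e).1 hsat
    cases b
    · simp only [forceAt, cond_false]
      rwa [Set.sdiff_singleton_eq_self (show s ∉ ({e} : Set ι) from fun h => hse h)]
    · simp only [forceAt, cond_true]
      exact hX (Set.subset_insert s {e}) hsing
  have hempty_not : ∀ {X : Set (Set ι)}, X ≠ Set.univ → ∀ (s : ι) (b : Bool), IsUpperSet X →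
      (b = true → ({s} : Set ι) ∉ X) → (∅ : Set ι) ∉ secAt s b X := by
    intro X hX s b hXu hb h
    rw [mem_secAt] at h
    cases b
    · simp only [forceAt, cond_false, Set.empty_sdiff] at h
      exact hX (Set.eq_univ_of_forall fun η => hXu (Set.empty_subset η) h)
    · simp only [forceAt, cond_true, insert_empty_eq] at h
      exact hb rfl h
  have heAs : ∀ {s : ι}, s ≠ e → ∀ b : Bool, (b = true → ({s} : Set ι) ∉ A) → e ∈ esupp (secAt s b A) := by
    intro s hse b hb
    rw [mem_esupp]
    exact ⟨∅, hempty_not hAnu s b hA hb, by rw [insert_empty_eq]; exact hsat_mem hA hsatA hse b⟩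
  have delB : ∀ s ∈ IAC, ∀ ω ∈ secAt s false C, ω ∈ B := by
    intro s hs ω hω
    have hsC := (mem_inter.1 hs).2
    have hse : s ≠ e := fun hse => heC (hse ▸ hsC)
    have hsB : s ∉ esupp B := fun h => hcommon s (mem_inter.1 hs).1 h hsC
    have hm := hmin s (by simp [(mem_inter.1 hs).1]) false
    rw [secAt_eq_self_of_not_affects hB (fun h => hsB (mem_esupp.2 h)) false] at hm
    have hAs : IsUpperSet (secAt s false A) := isUpperSet_secAt s false hA
    have hCs : IsUpperSet (secAt s false C) := isUpperSet_secAt s false hC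
    have heAs' := heAs hse false (fun h => absurd h Bool.false_ne_true)
    rcases (suppZeroFlag_three_iff_zVia _ _ _).1 hm with h | h | h
    · -- via (B, C_s), third A_s: impossible
      exfalso
      obtain ⟨dBCs, -, p2⟩ := zVia_pivotal hB hCs hAs h
      -- `C_s` ignores `IBC`, contains `IBC`, hence contains `∅`
      have h1 : (↑IBC : Set ι) ∈ secAt s false C := by
        rw [mem_secAt_false_iff_of_notMem (show s ∉ (↑IBC : Set ι) from fun h => hsB (mem_inter.1 h).1)]
        exact hIBCmem
      have h0 : (∅ : Set ι) ∈ secAt s false C := by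
        refine (mem_iff_of_inter_esupp_eq hCs (ω := ∅) (ω' := ↑IBC) ?_).2 h1
        ext i
        simp only [Set.empty_inter, Set.mem_empty_iff_false, Set.mem_inter_iff, mem_coe, false_iff, not_and]
        intro hiBC hiCs
        exact Finset.disjoint_left.1 dBCs (mem_inter.1 hiBC).1 hiCs
      refine p2 e heB ∅ h0 (hempty_not hAnu s false hA (fun h => absurd h Bool.false_ne_true)) ?_
      rw [insert_empty_eq]; exact hsat_mem hA hsatA hse false
    · -- via (A_s, C_s), third B: every ω ∈ C_s lies in B
      obtain ⟨-, -, p2⟩ := zVia_pivotal hAs hCs hB h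
      by_contra hωB
      exact p2 e heAs' ω hω hωB (hB (Set.singleton_subset_iff.2 (Set.mem_insert e ω))
        ((secAt_true_eq_univ_iff' hB e).1 hsatB))
    · exfalso
      exact Finset.disjoint_left.1 (zVia_pivotal hAs hB hCs h).1 heAs' heB
  -- symmetric: for `t ∈ IBC`, `C_t ⊆ A`
  have delA : ∀ t ∈ IBC, ∀ ω ∈ secAt t false C, ω ∈ A := by
    intro t ht ω hω
    have htC := (mem_inter.1 ht).2
    have hte : t ≠ e := fun hte => heC (hte ▸ htC)
    have htA : t ∉ esupp A := fun h => hcommon t h (mem_inter.1 ht).1 htC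
    have hm := hmin t (by simp [(mem_inter.1 ht).1]) false
    rw [secAt_eq_self_of_not_affects hA (fun h => htA (mem_esupp.2 h)) false] at hm
    have hBt : IsUpperSet (secAt t false B) := isUpperSet_secAt t false hB
    have hCt : IsUpperSet (secAt t false C) := isUpperSet_secAt t false hC
    have heBt : e ∈ esupp (secAt t false B) := by
      rw [mem_esupp]
      exact ⟨∅, hempty_not hBnu t false hB (fun h => absurd h Bool.false_ne_true),
        by rw [insert_empty_eq]; exact hsat_mem hB hsatB hte false⟩
    rcases (suppZeroFlag_three_iff_zVia _ _ _).1 hm with h | h | h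
    · -- via (B_t, C_t), third A: every ω ∈ C_t lies in A
      obtain ⟨-, -, p2⟩ := zVia_pivotal hBt hCt hA h
      by_contra hωA
      exact p2 e heBt ω hω hωA (hA (Set.singleton_subset_iff.2 (Set.mem_insert e ω))
        ((secAt_true_eq_univ_iff' hA e).1 hsatA))
    · -- via (A, C_t), third B_t: impossible
      exfalso
      obtain ⟨dACt, -, p2⟩ := zVia_pivotal hA hCt hBt h
      have h1 : (↑IAC : Set ι) ∈ secAt t false C := by
        rw [mem_secAt_false_iff_of_notMem (show t ∉ (↑IAC : Set ι) from fun h => htA (mem_inter.1 h).1)]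
        exact hIACmem
      have h0 : (∅ : Set ι) ∈ secAt t false C := by
        refine (mem_iff_of_inter_esupp_eq hCt (ω := ∅) (ω' := ↑IAC) ?_).2 h1
        ext i
        simp only [Set.empty_inter, Set.mem_empty_iff_false, Set.mem_inter_iff, mem_coe, false_iff, not_and]
        intro hiAC hiCt
        exact Finset.disjoint_left.1 dACt (mem_inter.1 hiAC).1 hiCt
      refine p2 e heA ∅ h0 (hempty_not hBnu t false hB (fun h => absurd h Bool.false_ne_true)) ?_
      rw [insert_empty_eq]; exact hsat_mem hB hsatB hte false
    · exfalso
      exact Finset.disjoint_left.1 (zVia_pivotal hA hBt hCt h).1 heA heBt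
  exact ⟨esA0', esB0', esC, hIACmem, hIBCmem, delB, delA⟩

end Summit.CriticalPhenomena.PercolationContinuityZ3.Theorems
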